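import Literature.MathematicalPhysics.QuantumFieldTheory.QCDOS
import Literature.MathematicalPhysics.QuantumLattice.GrassmannGaussianMeasureChange

/-!
# The Wilson-fermion Boltzmann factor is a polynomial in the bare quark masses

Stub `stub_fermiBoltzmannPolynomialInMass` of the line `Sketch` (infimum descent) for the crux
`SpectralDefectExtinction.ChiralDescent`.

For `N_f` flavours of Wilson quarks on a finite torus, the fermionic Boltzmann factor
`fermiBoltzmann U m = exp(-ψ̄ D(U, m) ψ)` is an explicit polynomial in the bare masses `m_f` with
Grassmann coefficients.  The proof is pure algebra:

* the Wilson–Dirac matrix is affine in the masses, `D(U, m) = D(U, 0) + Σ_f m_f P_f` with `P_f`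
  the projection onto the variables of flavour `f` (`neg_diracMatrix_eq`);
* `quadratic` is linear and central, so `exp(-ψ̄Dψ)` factors into `exp(-ψ̄D(U,0)ψ)` times the
  ordered product of the one-flavour factors `exp(-m_f ψ̄P_fψ)` (`grassmannExp_quadratic_add_sum`);
* `(ψ̄Aψ)^{|ι|+1} = 0` for every matrix `A` on the index set `ι` (`quadratic_pow_card_succ`: a sum
  of `|ι|` commuting square-zero terms), so each one-flavour exponential is the truncated series
  `Σ_{j ≤ |ι|} (-m_f)^j (ψ̄P_fψ)^j / j!` (`grassmannExp_quadratic_neg_smul`);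
* expanding the ordered product of these finite sums (`prod_ofFn_sum`, `prod_ofFn_smul`) gives
  the stated multi-index sum.
-/

noncomputable section

namespace Summit.QuantumFields.QCD.Cruxes.ChiralDescent.InfimumDescent

open Literature.MathematicalPhysics.QuantumLattice Literature.MathematicalPhysics.QuantumFieldTheory
  Literature.Probability.LatticeModels

/-- A finite sum of pairwise commuting square-zero elements raised beyond the number of summands
vanishes: `(Σ_{i ∈ s} tᵢ)^{|s|+1} = 0`. -/
theorem sum_pow_card_succ_eq_zero {M : Type*} [Ring M] {κ : Type*} (s : Finset κ) (t : κ → M)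
    (hsq : ∀ i ∈ s, t i ^ 2 = 0) (hc : ∀ i ∈ s, ∀ j ∈ s, Commute (t i) (t j)) :
    (∑ i ∈ s, t i) ^ (s.card + 1) = 0 := by
  classical
  induction s using Finset.induction_on with
  | empty => simp
  | @insert a s ha ih =>
    rw [Finset.sum_insert ha, Finset.card_insert_of_notMem ha]
    have ih' := ih (fun i hi => hsq i (Finset.mem_insert_of_mem hi))
      (fun i hi j hj => hc i (Finset.mem_insert_of_mem hi) j (Finset.mem_insert_of_mem hj))
    exact Commute.add_pow_eq_zero_of_add_le_succ_of_pow_eq_zero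
      (Commute.sum_right _ _ _ fun j hj =>
        hc a (Finset.mem_insert_self a s) j (Finset.mem_insert_of_mem hj))
      (hsq a (Finset.mem_insert_self a s)) ih' (by omega)

section Quadratic

variable (R : Type*) [CommRing R] {ι : Type*} [LinearOrder ι] [Fintype ι]

/-- The quadratic action raised beyond the number of fermion species vanishes:
`(ψ̄Aψ)^{|ι|+1} = 0` (it is the sum over `i` of the `|ι|` commuting square-zero terms
`ψ̄ᵢ (Σⱼ Aᵢⱼ ψⱼ)`). -/
theorem quadratic_pow_card_succ (A : Matrix ι ι R) :
    (quadratic R A) ^ (Fintype.card ι + 1) = 0 := by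
  have h : quadratic R A = ∑ i, (∑ j, A i j • (psiBar R i * psi R j)) := rfl
  rw [h, ← Finset.card_univ]
  refine sum_pow_card_succ_eq_zero _ _ (fun i _ => ?_) (fun i _ i' _ => ?_)
  · rw [pow_two, Finset.sum_mul_sum]
    refine Finset.sum_eq_zero fun j _ => Finset.sum_eq_zero fun j' _ => ?_
    rw [smul_mul_smul_comm, psiBar_mul_psi_mul_psiBar_mul_psi_self, smul_zero]
  · exact Commute.sum_left _ _ _ fun j _ => Commute.sum_right _ _ _ fun j' _ =>
      ((commute_psiBar_mul_psi R i j _).smul_left _).smul_right _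

variable [Algebra ℚ R]

/-- Iterated measure change: `exp ψ̄(A + Σᵢ Bᵢ)ψ = exp ψ̄Aψ · ∏ᵢ exp ψ̄Bᵢψ` (ordered product). -/
theorem grassmannExp_quadratic_add_sum {k : ℕ} (A : Matrix ι ι R) (B : Fin k → Matrix ι ι R) :
    grassmannExp (quadratic R (A + ∑ i, B i)) =
      grassmannExp (quadratic R A) * (List.ofFn fun i => grassmannExp (quadratic R (B i))).prod := by
  induction k generalizing A with
  | zero => simp
  | succ k ih =>
    rw [Fin.sum_univ_succ, ← add_assoc, ih (A + B 0) (fun i => B i.succ), grassmannExp_quadratic_add,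
      List.ofFn_succ, List.prod_cons, mul_assoc]

end Quadratic

/-- The one-flavour factor is a truncated exponential series:
`exp(-m ψ̄Pψ) = Σ_{j ≤ |ι|} m^j ((-1)^j / j!) (ψ̄Pψ)^j`. -/
theorem grassmannExp_quadratic_neg_smul {ι : Type*} [LinearOrder ι] [Fintype ι] (m : ℂ)
    (P : Matrix ι ι ℂ) :
    grassmannExp (quadratic ℂ ((-m) • P)) =
      ∑ j : Fin (Fintype.card ι + 1), (m ^ (j : ℕ)) •
        ((((-1 : ℂ) ^ (j : ℕ) / ((j : ℕ).factorial : ℂ))) • (quadratic ℂ P) ^ (j : ℕ)) := by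
  rw [quadratic_smul, grassmannExp, IsNilpotent.exp_eq_sum (k := Fintype.card ι + 1)
      (by rw [smul_pow, quadratic_pow_card_succ, smul_zero]),
    Finset.sum_range (fun i => ((i.factorial : ℚ)⁻¹ • ((-m) • quadratic ℂ P) ^ i))]
  refine Finset.sum_congr rfl fun j _ => ?_
  rw [smul_pow, ← Rat.cast_smul_eq_qsmul ℂ, smul_smul, smul_smul, Rat.cast_inv, Rat.cast_natCast,
    neg_pow, div_eq_mul_inv]
  congr 1
  ring

/-- Ordered product of finite sums, expanded: `∏ᵢ (Σⱼ Tᵢⱼ) = Σ_α ∏ᵢ T_{i, α i}`. -/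
theorem prod_ofFn_sum {M : Type*} [Semiring M] {X : Type*} [Fintype X] {k : ℕ} (T : Fin k → X → M) :
    (List.ofFn fun i => ∑ j, T i j).prod = ∑ α : Fin k → X, (List.ofFn fun i => T i (α i)).prod := by
  induction k with
  | zero => simp
  | succ k ih =>
    rw [List.ofFn_succ, List.prod_cons, ih (fun i => T i.succ), Finset.sum_mul_sum,
      ← Fintype.sum_prod_type']
    exact Fintype.sum_equiv (Fin.consEquiv fun _ => X) _ _ fun p => by
      simp only [Fin.consEquiv_apply, List.ofFn_succ, List.prod_cons, Fin.cons_zero, Fin.cons_succ]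

/-- Scalars pulled out of an ordered product: `∏ᵢ (cᵢ • xᵢ) = (∏ᵢ cᵢ) • ∏ᵢ xᵢ`. -/
theorem prod_ofFn_smul {M : Type*} [Ring M] [Algebra ℂ M] {k : ℕ} (c : Fin k → ℂ) (x : Fin k → M) :
    (List.ofFn fun i => c i • x i).prod = (∏ i, c i) • (List.ofFn x).prod := by
  induction k with
  | zero => simp
  | succ k ih =>
    rw [List.ofFn_succ, List.prod_cons, ih (fun i => c i.succ) (fun i => x i.succ), smul_mul_smul_comm,
      Fin.prod_univ_succ, List.ofFn_succ, List.prod_cons]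

/-- The Wilson–Dirac matrix is affine in the bare mass:
`D_W(U, m, r) = D_W(U, 0, r) + m · 1`. -/
theorem wilsonDirac_mass_split {L N : ℕ} {G : Type*} [Group G] (ρ : G →* Matrix (Fin N) (Fin N) ℂ)
    (U : GaugeConfig 4 L G) (m r : ℝ) (p q : TorusSite 4 L × Fin N × Fin 4) :
    wilsonDirac ρ U m r p q = wilsonDirac ρ U 0 r p q + if p = q then (m : ℂ) else 0 := by
  simp only [wilsonDirac, Matrix.of_apply]
  split_ifs <;> push_cast <;> ring

/-- Mass decomposition of the `N_f`-flavour Dirac matrix: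
`-D(U, m) = -D(U, 0) + Σ_f (-m_f) P_f`, `P_f` the projection onto flavour `f`. -/
theorem neg_diracMatrix_eq {Nf S : ℕ} [NeZero S]
    (U : GaugeConfig 4 S ↥(Matrix.specialUnitaryGroup (Fin 3) ℂ)) (mq : Fin Nf → ℝ) :
    -diracMatrix U mq = -diracMatrix U 0 +
      ∑ f, (-((mq f : ℝ) : ℂ)) • Matrix.reindex quarkEquiv quarkEquiv
        (Matrix.of fun v w : QuarkVar Nf S => if v = w ∧ v.1 = f then (1 : ℂ) else 0) := by
  ext a b
  simp only [diracMatrix, Matrix.neg_apply, Matrix.add_apply, Matrix.sum_apply, Matrix.smul_apply,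
    Matrix.reindex_apply, Matrix.submatrix_apply, Matrix.of_apply, smul_eq_mul, Pi.zero_apply]
  generalize quarkEquiv.symm a = v
  generalize quarkEquiv.symm b = w
  obtain ⟨f₁, p⟩ := v
  obtain ⟨f₂, q⟩ := w
  rw [wilsonDirac_mass_split (fundamentalRep (Fin 3)) U (mq f₁) 1 p q]
  by_cases hf : f₁ = f₂
  · subst hf
    by_cases hp : p = q
    · subst hp
      simp only [if_true, true_and, mul_ite, mul_one, mul_zero, Finset.sum_ite_eq, Finset.mem_univ]
      ring
    · simp [hp]
  · simp [hf]

/-- **The Wilson-fermion Boltzmann factor is an explicit polynomial in the bare masses.** -/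
theorem stub_fermiBoltzmannPolynomialInMass :
    ∀ (Nf S : ℕ) [NeZero S] (U : GaugeConfig 4 S ↥(Matrix.specialUnitaryGroup (Fin 3) ℂ)) (mq : Fin Nf → ℝ),
      fermiBoltzmann U mq =
        ∑ α : Fin Nf → Fin (Fintype.card (FermiIdx Nf S) + 1),
          (∏ f, ((mq f : ℝ) : ℂ) ^ (α f : ℕ)) •
            (fermiBoltzmann U 0 *
              (List.ofFn fun f : Fin Nf =>
                ((-1 : ℂ) ^ (α f : ℕ) / ((α f : ℕ).factorial : ℂ)) •
                  (quadratic ℂ (Matrix.reindex quarkEquiv quarkEquiv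
                    (Matrix.of fun v w : QuarkVar Nf S => if v = w ∧ v.1 = f then (1 : ℂ) else 0))) ^ (α f : ℕ)).prod) := by
  intro Nf S _ U mq
  rw [fermiBoltzmann, fermiBoltzmann, neg_diracMatrix_eq U mq, grassmannExp_quadratic_add_sum]
  simp_rw [grassmannExp_quadratic_neg_smul, prod_ofFn_sum, prod_ofFn_smul, Finset.mul_sum, mul_smul_comm]

end Summit.QuantumFields.QCD.Cruxes.ChiralDescent.InfimumDescent
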